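import Mathlib
import Summits.QuantumFields.QCD.Theorems.SpectralDefectExtinctionWegnerEstimateSketchDefs

/-!
# Single-link resonance (S2c of line `corner-decorrelation-deep-hole`): the `su(3)` rigidity inequality

For unit vectors `v, w ∈ ℂ³` and the explicit basis `X₀,…,X₇` of `su(3)` (`su3Basis`),

  `Σ_{i<8} (Im ⟨w, Xᵢ v⟩)² ≥ (‖v‖²‖w‖² − (Im ⟨v, w⟩)²)/2`.

Proof: with `M = (v w† + w v†)/2` (Hermitian), the eight numbers `Im⟨w, Xᵢv⟩` are `2 Im M_{ba}`,
`2 Re M_{ab}` (`a < b`) and the diagonal differences `M₀₀ − M₁₁`, `M₁₁ − M₂₂`; an exact sum-of-squares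
identity gives `Σ gᵢ² = (‖v‖²‖w‖² − y²)/2 + x²/6 + ½Σ_{i<6} gᵢ² + (g₆ − g₇)²/3` with
`x + iy = ⟨v, w⟩`.  This is the pointwise input of the Hellmann–Feynman rigidity along the eight one-link
circles (cluster Hellmann–Feynman reduces every circle derivative of a resonant eigenvalue to such a `gᵢ`).
-/

namespace Summit.QuantumFields.QCD.Cruxes.WindowExtinction.CornerDecorrelationDeepHole

open scoped BigOperators Matrix ComplexConjugate
open Matrix
open Summit.QuantumFields.QCD.Cruxes.WegnerEstimate.ResolventCell (su3Basis)

/-- **The `su(3)` rigidity inequality in real coordinates** (`v_a = p_a + i q_a`, `w_a = r_a + i s_a`):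
an exact sum-of-squares identity. -/
theorem cornerSL_rigidity_real (p0 p1 p2 q0 q1 q2 r0 r1 r2 s0 s1 s2 : ℝ) :
    ((p0 ^ 2 + q0 ^ 2 + (p1 ^ 2 + q1 ^ 2) + (p2 ^ 2 + q2 ^ 2)) *
        (r0 ^ 2 + s0 ^ 2 + (r1 ^ 2 + s1 ^ 2) + (r2 ^ 2 + s2 ^ 2)) -
      (p0 * s0 - q0 * r0 + (p1 * s1 - q1 * r1) + (p2 * s2 - q2 * r2)) ^ 2) / 2 ≤
    ((r0 * q1 - s0 * p1) - (r1 * q0 - s1 * p0)) ^ 2 + ((r0 * q2 - s0 * p2) - (r2 * q0 - s2 * p0)) ^ 2 +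
      ((r1 * q2 - s1 * p2) - (r2 * q1 - s2 * p1)) ^ 2 +
      ((r0 * p1 + s0 * q1) + (r1 * p0 + s1 * q0)) ^ 2 + ((r0 * p2 + s0 * q2) + (r2 * p0 + s2 * q0)) ^ 2 +
      ((r1 * p2 + s1 * q2) + (r2 * p1 + s2 * q1)) ^ 2 +
      ((r0 * p0 + s0 * q0) - (r1 * p1 + s1 * q1)) ^ 2 + ((r1 * p1 + s1 * q1) - (r2 * p2 + s2 * q2)) ^ 2 := by
  linarith [sq_nonneg ((r0 * q1 - s0 * p1) - (r1 * q0 - s1 * p0)), sq_nonneg ((r0 * q2 - s0 * p2) - (r2 * q0 - s2 * p0)),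
    sq_nonneg ((r1 * q2 - s1 * p2) - (r2 * q1 - s2 * p1)), sq_nonneg ((r0 * p1 + s0 * q1) + (r1 * p0 + s1 * q0)),
    sq_nonneg ((r0 * p2 + s0 * q2) + (r2 * p0 + s2 * q0)), sq_nonneg ((r1 * p2 + s1 * q2) + (r2 * p1 + s2 * q1)),
    sq_nonneg (((r0 * p0 + s0 * q0) - (r1 * p1 + s1 * q1)) - ((r1 * p1 + s1 * q1) - (r2 * p2 + s2 * q2))),
    sq_nonneg (p0 * r0 + q0 * s0 + (p1 * r1 + q1 * s1) + (p2 * r2 + q2 * s2))]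

/-- Components of `Im ⟨w, Xᵢ v⟩` for the eight basis matrices, and of `⟨v, w⟩`, `‖v‖²`, in real coordinates. -/
theorem cornerSL_rigidity_components (v w : Fin 3 → ℂ) :
    (star w ⬝ᵥ (su3Basis 0 *ᵥ v)).im =
        ((w 0).re * (v 1).im - (w 0).im * (v 1).re) - ((w 1).re * (v 0).im - (w 1).im * (v 0).re) ∧
    (star w ⬝ᵥ (su3Basis 1 *ᵥ v)).im =
        ((w 0).re * (v 2).im - (w 0).im * (v 2).re) - ((w 2).re * (v 0).im - (w 2).im * (v 0).re) ∧
    (star w ⬝ᵥ (su3Basis 2 *ᵥ v)).im =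
        ((w 1).re * (v 2).im - (w 1).im * (v 2).re) - ((w 2).re * (v 1).im - (w 2).im * (v 1).re) ∧
    (star w ⬝ᵥ (su3Basis 3 *ᵥ v)).im =
        ((w 0).re * (v 1).re + (w 0).im * (v 1).im) + ((w 1).re * (v 0).re + (w 1).im * (v 0).im) ∧
    (star w ⬝ᵥ (su3Basis 4 *ᵥ v)).im =
        ((w 0).re * (v 2).re + (w 0).im * (v 2).im) + ((w 2).re * (v 0).re + (w 2).im * (v 0).im) ∧
    (star w ⬝ᵥ (su3Basis 5 *ᵥ v)).im =
        ((w 1).re * (v 2).re + (w 1).im * (v 2).im) + ((w 2).re * (v 1).re + (w 2).im * (v 1).im) ∧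
    (star w ⬝ᵥ (su3Basis 6 *ᵥ v)).im =
        ((w 0).re * (v 0).re + (w 0).im * (v 0).im) - ((w 1).re * (v 1).re + (w 1).im * (v 1).im) ∧
    (star w ⬝ᵥ (su3Basis 7 *ᵥ v)).im =
        ((w 1).re * (v 1).re + (w 1).im * (v 1).im) - ((w 2).re * (v 2).re + (w 2).im * (v 2).im) ∧
    (star v ⬝ᵥ w).im =
        ((v 0).re * (w 0).im - (v 0).im * (w 0).re + ((v 1).re * (w 1).im - (v 1).im * (w 1).re) +
          ((v 2).re * (w 2).im - (v 2).im * (w 2).re)) ∧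
    (∑ a, ‖v a‖ ^ 2) = (v 0).re ^ 2 + (v 0).im ^ 2 + ((v 1).re ^ 2 + (v 1).im ^ 2) + ((v 2).re ^ 2 + (v 2).im ^ 2) := by
  simp only [su3Basis, dotProduct, Matrix.mulVec, Fin.sum_univ_three, Matrix.cons_val', Matrix.cons_val_zero,
    Matrix.cons_val_one, Matrix.cons_val_two, Matrix.head_cons, Matrix.tail_cons, Matrix.empty_val',
    Matrix.cons_val_fin_one, Matrix.of_apply, Pi.star_apply, Complex.star_def]
  refine ⟨?_, ?_, ?_, ?_, ?_, ?_, ?_, ?_, ?_, ?_⟩ <;>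
    simp [Complex.mul_re, Complex.mul_im, Complex.add_im, Complex.sq_norm, Complex.normSq_apply] <;> ring

/-- **The `su(3)` rigidity inequality** for vectors `v, w ∈ ℂ³`:
`Σ_{i<8} (Im ⟨w, Xᵢ v⟩)² ≥ (‖v‖²‖w‖² − (Im⟨v,w⟩)²)/2`. -/
theorem cornerSL_rigidity (v w : Fin 3 → ℂ) :
    ((∑ a, ‖v a‖ ^ 2) * (∑ a, ‖w a‖ ^ 2) - (star v ⬝ᵥ w).im ^ 2) / 2 ≤
      ∑ i : Fin 8, (star w ⬝ᵥ (su3Basis i *ᵥ v)).im ^ 2 := by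
  obtain ⟨h0, h1, h2, h3, h4, h5, h6, h7, hy, hv⟩ := cornerSL_rigidity_components v w
  obtain ⟨-, -, -, -, -, -, -, -, -, hw⟩ := cornerSL_rigidity_components w v
  rw [Fin.sum_univ_eight, h0, h1, h2, h3, h4, h5, h6, h7, hy, hv, hw]
  exact cornerSL_rigidity_real _ _ _ _ _ _ _ _ _ _ _ _

/-- The quadratic form of the "imaginary part" `(−i/2)(a A − ā Aᴴ)` of a phased matrix is
`Im (a · u†Au)`. -/
theorem cornerSL_quadForm_imPart (A : Matrix (Fin 3) (Fin 3) ℂ) (a : ℂ) (u : Fin 3 → ℂ) :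
    (star u ⬝ᵥ (((-Complex.I / 2) • (a • A - (starRingEnd ℂ a) • Aᴴ)) *ᵥ u)).re =
      (a * (star u ⬝ᵥ (A *ᵥ u))).im := by
  rw [Matrix.smul_mulVec, dotProduct_smul, Matrix.sub_mulVec, dotProduct_sub, Matrix.smul_mulVec,
    Matrix.smul_mulVec, dotProduct_smul, dotProduct_smul,
    (show star u ⬝ᵥ (Aᴴ *ᵥ u) = star (star u ⬝ᵥ (A *ᵥ u)) by
      rw [Matrix.dotProduct_mulVec, ← Matrix.star_mulVec, Matrix.star_dotProduct])]
  set ζ : ℂ := star u ⬝ᵥ (A *ᵥ u)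
  simp only [smul_eq_mul, Complex.star_def]
  have : (starRingEnd ℂ) a * (starRingEnd ℂ) ζ = (starRingEnd ℂ) (a * ζ) := by rw [map_mul]
  rw [this, Complex.sub_conj]
  simp [Complex.mul_re, Complex.mul_im]
  ring

/-- **Point rigidity.**  Let `M, N ∈ U(3)`, `Y = M N`, `φ₀ ∈ ℝ`, and let `u` be a unit eigenvector, with
eigenvalue `s`, `|s| ≤ 1/2`, of the Hermitian matrix `S(Y) = (−i/2)(e^{−iφ₀}Y − e^{iφ₀}Yᴴ)` (whose spectrum is
`{Im(e^{−iφ₀}σ) : σ ∈ spec Y}`).  Then the eight "currents"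
`Re u† [(−i/2)(e^{−iφ₀} M Xᵢ N − e^{iφ₀}(M Xᵢ N)ᴴ)] u` (the derivatives of the quadratic form of `S` along the
eight one-parameter circles `Y ↦ M exp(tXᵢ) N`) have total absolute size `≥ 1/2`. -/
theorem cornerSL_point_rigidity (M N : Matrix (Fin 3) (Fin 3) ℂ) (hM : M ∈ Matrix.unitaryGroup (Fin 3) ℂ)
    (hN : N ∈ Matrix.unitaryGroup (Fin 3) ℂ) (φ₀ : ℝ) (u : Fin 3 → ℂ) (hu : star u ⬝ᵥ u = 1) (s : ℝ)
    (hs : |s| ≤ 1 / 2)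
    (hHu : ((-Complex.I / 2) • (Complex.exp (-(φ₀ * Complex.I)) • (M * N) -
        (starRingEnd ℂ (Complex.exp (-(φ₀ * Complex.I)))) • (M * N)ᴴ)) *ᵥ u = (s : ℂ) • u) :
    (1 / 2 : ℝ) ≤ ∑ i : Fin 8, |(star u ⬝ᵥ (((-Complex.I / 2) • (Complex.exp (-(φ₀ * Complex.I)) • (M * su3Basis i * N) -
        (starRingEnd ℂ (Complex.exp (-(φ₀ * Complex.I)))) • (M * su3Basis i * N)ᴴ)) *ᵥ u)).re| := by
  set a : ℂ := Complex.exp (-(φ₀ * Complex.I)) with ha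
  -- the two unit vectors
  set v' : Fin 3 → ℂ := N *ᵥ u with hv'
  set w' : Fin 3 → ℂ := (starRingEnd ℂ a) • (Mᴴ *ᵥ u) with hw'
  have hMu : M * Mᴴ = 1 := Matrix.mem_unitaryGroup_iff.mp hM
  have hNu' : Nᴴ * N = 1 := Matrix.mem_unitaryGroup_iff'.mp hN
  have haa : a * starRingEnd ℂ a = 1 := by
    rw [Complex.mul_conj, Complex.normSq_eq_norm_sq, ha, Complex.norm_exp]
    simp
  -- the currents are the `gᵢ` of `(v', w')`
  have hkey : ∀ X : Matrix (Fin 3) (Fin 3) ℂ, star w' ⬝ᵥ (X *ᵥ v') = a * (star u ⬝ᵥ ((M * X * N) *ᵥ u)) := by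
    intro X
    rw [hw', hv', star_smul, Complex.star_def, Complex.conj_conj, Matrix.star_mulVec,
      Matrix.conjTranspose_conjTranspose, smul_dotProduct, ← Matrix.dotProduct_mulVec, Matrix.mulVec_mulVec,
      Matrix.mulVec_mulVec, smul_eq_mul]
  have hg : ∀ i : Fin 8, (star u ⬝ᵥ (((-Complex.I / 2) • (a • (M * su3Basis i * N) -
        (starRingEnd ℂ a) • (M * su3Basis i * N)ᴴ)) *ᵥ u)).re = (star w' ⬝ᵥ (su3Basis i *ᵥ v')).im := by
    intro i
    rw [cornerSL_quadForm_imPart, hkey]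
  -- norms
  have hnorm : ∀ x : Fin 3 → ℂ, (∑ b, ‖x b‖ ^ 2) = (star x ⬝ᵥ x).re := by
    intro x
    simp only [dotProduct, Pi.star_apply, Complex.re_sum]
    refine Finset.sum_congr rfl fun b _ => ?_
    rw [Complex.star_def, ← Complex.normSq_eq_conj_mul_self, Complex.normSq_eq_norm_sq]
    norm_cast
  have hv'1 : (∑ b, ‖v' b‖ ^ 2) = 1 := by
    rw [hnorm, hv', Matrix.star_mulVec, ← Matrix.dotProduct_mulVec, Matrix.mulVec_mulVec, hNu', Matrix.one_mulVec,
      hu, Complex.one_re]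
  have hw'1 : (∑ b, ‖w' b‖ ^ 2) = 1 := by
    rw [hnorm, hw', star_smul, smul_dotProduct, dotProduct_smul, smul_smul, Complex.star_def, Complex.conj_conj,
      haa, one_smul, Matrix.star_mulVec, ← Matrix.dotProduct_mulVec, Matrix.conjTranspose_conjTranspose,
      Matrix.mulVec_mulVec, hMu, Matrix.one_mulVec, hu, Complex.one_re]
  -- `Im ⟨v', w'⟩ = −s`
  have hHuq : (star u ⬝ᵥ (((-Complex.I / 2) • (a • (M * N) - (starRingEnd ℂ a) • (M * N)ᴴ)) *ᵥ u)).re = s := by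
    rw [hHu, dotProduct_smul, hu, smul_eq_mul, mul_one, Complex.ofReal_re]
  have hy : (star v' ⬝ᵥ w').im = -s := by
    rw [← hHuq, cornerSL_quadForm_imPart, hv', hw', dotProduct_smul, Matrix.star_mulVec, ← Matrix.dotProduct_mulVec,
      Matrix.mulVec_mulVec, ← Matrix.conjTranspose_mul,
      (show star u ⬝ᵥ ((M * N)ᴴ *ᵥ u) = star (star u ⬝ᵥ ((M * N) *ᵥ u)) by
        rw [Matrix.dotProduct_mulVec, ← Matrix.star_mulVec, Matrix.star_dotProduct]), smul_eq_mul,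
      Complex.star_def, ← map_mul, Complex.conj_im]
  -- rigidity
  have hrig := cornerSL_rigidity v' w'
  rw [hv'1, hw'1, hy] at hrig
  have hs2 : s ^ 2 ≤ 1 / 4 := by
    have := abs_le.mp hs
    nlinarith
  simp_rw [hg]
  -- `Σ gᵢ² ≤ (Σ |gᵢ|)²`
  set G : Fin 8 → ℝ := fun i => (star w' ⬝ᵥ (su3Basis i *ᵥ v')).im with hG
  have hsq : ∑ i : Fin 8, G i ^ 2 ≤ (∑ i : Fin 8, |G i|) ^ 2 := by
    have h1 : ∑ i : Fin 8, G i ^ 2 = ∑ i : Fin 8, |G i| ^ 2 := by simp [sq_abs]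
    rw [h1]
    exact Finset.sum_sq_le_sq_sum_of_nonneg fun i _ => abs_nonneg _
  have hge : (3 / 8 : ℝ) ≤ (∑ i : Fin 8, |G i|) ^ 2 := by
    have : (3 / 8 : ℝ) ≤ ∑ i : Fin 8, G i ^ 2 := by
      have h' : (-s) ^ 2 = s ^ 2 := by ring
      rw [h'] at hrig
      linarith
    exact this.trans hsq
  nlinarith [Finset.sum_nonneg (fun i (_ : i ∈ (Finset.univ : Finset (Fin 8))) => abs_nonneg (G i))]

end Summit.QuantumFields.QCD.Cruxes.WindowExtinction.CornerDecorrelationDeepHole
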